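import Literature.MathematicalPhysics.QuantumFieldTheory.Balaban1983to89.B15Prop1ChartCalculusSU2
import Literature.MathematicalPhysics.QuantumFieldTheory.Balaban1983to89.B15Prop1SliceCoordinates
import Literature.MathematicalPhysics.QuantumFieldTheory.Balaban1983to89.T4AxialGaugeFixing

/-!
# `Balaban1983to89.B15Prop1CriticalViaSlice` — [Balaban1989LargeFieldII] p. 359 *«Fixing the gauge G₀ for V′ … we can write
# V′ = exp iB′. We expand the function with respect to B′ … Now the condition for a critical configuration is the equation (1.12)»*:
# CRITICALITY IN ALL DIRECTIONS ⇔ CRITICALITY IN PRINT'S GAUGE-FIXED COORDINATES — the (c3) letter of the N12∕s1 chain as a THEOREM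
# of chart calculus, for a Λ-invariant function differentiable through the chart

statement-level skeleton of published theorems with citation tags; proofs where landed; nothing here is a claim about
the Yang–Mills mass gap

Cell pub-ymgap, HUMAN RULING D-0062 (Track A full width), seat `pub-ymgap-dag-n12-c` (R134 acceleration seat (a), strategy s1 of DAG
node N12 = [B15]; generation g4, second product).  PDF held: `paper:balaban1989-cmp122-large-field-ii` (journal page = PDF page + 354;
p. 359 = PDF 5).

THE PRINT.  [LF-II] p. 359: *«we consider the variational problem for the function V′↾_Λ → A(U_{k,Z}(V′V_k)), where V′ satisfies mild
regularity conditions. Fixing the gauge G₀ for V′ we get a small configuration, and we can write V′ = exp iB′. We expand the function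
with respect to B′ … Now the condition for a critical configuration is the equation (1.12)»*; [IV] p. 194: *«The function is invariant
with respect to the group of all gauge transformations defined on Λ … there exists exactly one critical orbit of the function (1.77)»*.
The carrier of record reads *«critical»* as `B15Prop1Carrier.IsCriticalPt ch Λb f V`: EVERY left-multiplicative variation
`s ↦ f(exp(isA)·V)`, `A` supported on the bonds `Λb` meeting `Λ^{(k)}`, is stationary at `s = 0`.  Print's sentence replaces this by
the stationarity of the GAUGE-FIXED COORDINATE variations `s ↦ f(exp(i·ιA(B′ + sδB′))·Ṽ)` (`B′, δB′` zero on `G₀`).  The N12∕s1 chain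
(`B15Prop1AdjointOfRecord.exists_domain_prop1Printed_lfVarOn_std_su2_box`, p485420) displays the equivalence as its letter (c3) `hc3`.

WHAT THIS FILE PROVES (Mathlib + the three imports; `G = SU(2)`, Lie algebra `ℝ³`, chart `su2Chart`; no `sorry`, no `… : Prop` fact,
no `instance`, no `notation`; the `def`s are explicit objects with bodies; axioms standard).  For a site set `S` (`= Λ^{(k)}`), a bond
set `T` (`= G₀`) carrying a fresh-endpoint order `TreeOrder T v r` (pv26) with fresh ends in `S`, a function `f` INVARIANT under the
gauge transformations defined on `S`, a chart point `V = exp(i·ιA B)·U` with `‖B‖ ≤ 1/2`, and a Fréchet derivative `D` of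
`A ↦ f(exp(iA)·V)` at `A = 0`:
§2 THE CHART CHANGE: `Theta S T B : GaugeSlice →ₗ (bonds → ℝ³)` (bondwise `B15Prop1ChartCalculusSU2.theta`), supported on the free
   bonds and ONTO the fields supported there (`exists_Theta_eq`, `‖B‖ ≤ 1/2`); `sliceCurve` with `exp(i·sliceCurve s)·V =
   exp(i·ιA(B + sδ))·U` (`expMul_sliceCurve`) and velocity `Theta B δ`; ★ **`hasDerivAt_slice_of_hasFDerivAt`**: print's coordinate
   variation has derivative `D (Theta B δ)` at `s = 0`.
§1 THE GAUGE DIRECTIONS: the one-parameter family `gaugeFamily λ s = exp(isλ)` of transformations defined on `S`, the infinitesimal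
   gauge field `dGauge V λ (b) = λ(b₋) − Ad_{V(b)} λ(b₊)`, `expMul_gaugeVecCurve` (`exp(i·gaugeVecCurve s)·V = V^{exp(isλ)}`), and
   ★ **`apply_dGauge_eq_zero`**: `D (dGauge V λ) = 0` — the derivative of an invariant function vanishes on gauge directions.
§3 THE INFINITESIMAL TREE GAUGE ★ **`exists_dGauge_eq`**: along a `TreeOrder`, every bond field `A` is matched ON `T` by an infinitesimal
   gauge field `dGauge V λ` with `λ` supported on the fresh ends (peeling induction as in dag-n12-c's finite
   `B15Prop1GaugeFixing.exists_gaugeTransf_freshSupport`, correcting at the fresh end with `Ad_{V(b)}^{±1}`).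
§4 ASSEMBLY ★★ **`isCriticalPt_iff_forall_theta`**: `IsCriticalPt su2Chart (bondsOf S) f V ↔ ∀ δ, D (Theta B δ) = 0` (⇒: the fields
   `Theta B δ` are admissible directions; ⇐: `A = (A − dGauge V λ) + dGauge V λ` with the first summand supported on the free bonds,
   hence in the range of `Theta B`, and the second killed by invariance); ★★ **`isCriticalPt_iff_forall_hasDerivAt_slice`** (`↔` every
   coordinate variation is stationary) and ★★ **`isCriticalPt_iff_of_hasDerivAt`** (`↔ ∀ δ, L δ = 0` for ANY displayed first variation
   `L` — the literal shape of the letter (c3) given the letter (m5) `hA`).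

HONEST SCOPE.  (i) The differentiability of `f` through the chart at the point `V` (`hF`) is a HYPOTHESIS — at print's instance
`f = A(U_{k,Z}(·))` it is part of the analyticity of [15]'s minimiser, a NODE 00 piece of record like the letter (m5); this file does
not prove it.  (ii) `‖B‖ ≤ 1/2` (injectivity domain of `d exp` used by `B15Prop1ChartCalculusSU2`); print: *«B′ … small»*.  (iii) `SU(2)`
only.  (iv) The instance `T = G₀` of a parallelepiped and the knit into the N12∕s1 endpoint are the companion `B15Prop1CriticalAtBoxG0`.
Count-neutral; NOT a discharge of N12; NOT summit progress; nothing continuum ∕ OS ∕ mass-gap ∕ Clay.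
-/

noncomputable section

open Set NormedSpace Filter
open scoped Real Topology

namespace Literature.MathematicalPhysics.QuantumFieldTheory.Balaban1983to89.B15Prop1CriticalViaSlice

open B16Sect1Backgrounds B15Prop1Carrier B15DeterminingSets GaugeField B15Prop1ChartSU2 B15Prop1ChartCalculusSU2
open B15Prop1SliceCoordinates (GaugeSlice ιA freeBonds mem_freeBonds ιA_apply_of_mem ιA_apply_of_not_mem norm_ιA_apply_le)
open T4CubeChartGnomonic (SU2)
open T4AxialGaugeFixing (TreeOrder)

variable {P : Params} {k : ℕ}

/-! ## §1 The gauge directions (no coordinates needed) -/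

/-- The one-parameter family `u_s = exp(isλ)` of gauge transformations generated by a site field `λ`.
[cite: Balaban1989LargeFieldI, (1.77) p.194 («the group of all gauge transformations defined on Λ»)] -/
def gaugeFamily (lam : SiteField P k E3) (s : ℝ) : GaugeTransf P k SU2 := fun x => su2Chart.iexp (s • lam x)

/-- If `λ` vanishes off `S`, every `u_s` is defined on `S` (`= 1` off `S`). [cite: Balaban1989LargeFieldI, (1.77) p.194] -/
theorem isGaugeOn_gaugeFamily {S : Set (Site P k)} {lam : SiteField P k E3} (hlam : ∀ x, x ∉ S → lam x = 0) (s : ℝ) :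
    IsGaugeOn S (gaugeFamily lam s) := fun x hx => by
  show su2Chart.iexp (s • lam x) = 1
  rw [hlam x hx, smul_zero, su2Chart.iexp_zero]

/-- **THE INFINITESIMAL GAUGE FIELD** `dGauge V λ (b) = λ(b₋) − Ad_{V(b)} λ(b₊)`: the velocity at `s = 0`, in left-multiplicative
coordinates at `V`, of the orbit curve `s ↦ V^{u_s}`. [cite: Balaban1989LargeFieldI, (1.77) p.194] -/
def dGauge (V : GaugeField P k SU2) (lam : SiteField P k E3) : VecField P k E3 := fun b => lam b.src - adSU2 (V b) (lam b.tgt)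

/-- `dGauge` unfolded. [cite: Balaban1989LargeFieldI, (1.77) p.194] -/
theorem dGauge_apply (V : GaugeField P k SU2) (lam : SiteField P k E3) (b : PBond P k) :
    dGauge V lam b = lam b.src - adSU2 (V b) (lam b.tgt) := rfl

/-- `dGauge V λ` is supported on the bonds meeting the support of `λ`. [cite: Balaban1989LargeFieldI, (1.77) p.194] -/
theorem dGauge_apply_of_not_mem {S : Set (Site P k)} {lam : SiteField P k E3} (hlam : ∀ x, x ∉ S → lam x = 0)
    (V : GaugeField P k SU2) {b : PBond P k} (hb : b ∉ bondsOf S) : dGauge V lam b = 0 := by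
  have hs : b.src ∉ S := fun h => hb (Or.inl h)
  have ht : b.tgt ∉ S := fun h => hb (Or.inr h)
  rw [dGauge_apply, hlam _ hs, hlam _ ht, map_zero, sub_zero]

/-- The left-multiplicative coordinate curve of the orbit: `gaugeVecCurve V λ s (b) = gaugeCurve (V b) (λ b₋) (λ b₊) s`.
[cite: Balaban1989LargeFieldI, (1.77) p.194] -/
def gaugeVecCurve (V : GaugeField P k SU2) (lam : SiteField P k E3) (s : ℝ) : VecField P k E3 :=
  fun b => gaugeCurve (V b) (lam b.src) (lam b.tgt) s

/-- **`exp(i·gaugeVecCurve s)·V = V^{u_s}`** for every `s`. [cite: Balaban1989LargeFieldI, (1.77) p.194] -/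
theorem expMul_gaugeVecCurve (V : GaugeField P k SU2) (lam : SiteField P k E3) (s : ℝ) :
    expMul su2Chart (gaugeVecCurve V lam s) V = gaugeAct (gaugeFamily lam s) V := by
  funext b
  exact iexp_gaugeCurve_mul (V b) (lam b.src) (lam b.tgt) s

/-- The orbit curve starts at `0`. [cite: Balaban1989LargeFieldI, (1.77) p.194] -/
theorem gaugeVecCurve_zero (V : GaugeField P k SU2) (lam : SiteField P k E3) : gaugeVecCurve V lam 0 = 0 :=
  funext fun _ => gaugeCurve_zero _ _ _

/-- The orbit curve has velocity `dGauge V λ` at `s = 0`. [cite: Balaban1989LargeFieldI, (1.77) p.194] -/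
theorem hasDerivAt_gaugeVecCurve (V : GaugeField P k SU2) (lam : SiteField P k E3) :
    HasDerivAt (gaugeVecCurve V lam) (dGauge V lam) 0 :=
  hasDerivAt_pi.2 fun _ => hasDerivAt_gaugeCurve _ _ _

/-- **THE DERIVATIVE OF AN INVARIANT FUNCTION VANISHES ON GAUGE DIRECTIONS**: if `f` is invariant under the gauge transformations
defined on `S`, `λ` vanishes off `S`, and `A ↦ f(exp(iA)·V)` has Fréchet derivative `D` at `0`, then `D (dGauge V λ) = 0` (`s ↦
f(V^{u_s})` is constant). [cite: Balaban1989LargeFieldI, (1.77) p.194 («The function is invariant with respect to the group of all gauge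
transformations defined on Λ»)] -/
theorem apply_dGauge_eq_zero {S : Set (Site P k)} {f : GaugeField P k SU2 → ℝ}
    (hf : ∀ u : GaugeTransf P k SU2, IsGaugeOn S u → ∀ V, f (gaugeAct u V) = f V) {lam : SiteField P k E3}
    (hlam : ∀ x, x ∉ S → lam x = 0) {V : GaugeField P k SU2} {D : VecField P k E3 →L[ℝ] ℝ}
    (hF : HasFDerivAt (fun A => f (expMul su2Chart A V)) D 0) : D (dGauge V lam) = 0 := by
  have h := hF.comp_hasDerivAt_of_eq 0 (hasDerivAt_gaugeVecCurve V lam) (gaugeVecCurve_zero V lam).symm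
  have hconst : (fun A => f (expMul su2Chart A V)) ∘ gaugeVecCurve V lam = fun _ => f V := by
    funext s
    rw [Function.comp_apply, expMul_gaugeVecCurve]
    exact hf _ (isGaugeOn_gaugeFamily hlam s) V
  rw [hconst] at h
  exact h.unique (hasDerivAt_const (0 : ℝ) (f V))

section Slice

variable [DecidableEq (PBond P k)]

/-! ## §2 The chart change at the lattice level -/

/-- **THE CHART-CHANGE MAP `Θ_B`** on the gauge-fixed coordinate space: `Theta S T B δ (b) = theta (ιA B b) (ιA δ b)` — the bond field
(supported on the free bonds) whose left-multiplicative variation `exp(isΘ_Bδ)·V`, `V = exp(i·ιA B)·U`, is print's coordinate variation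
`exp(i·ιA(B + sδ))·U` to first order. [cite: Balaban1989LargeFieldII, p.359 («we can write V′ = exp iB′. We expand the function with
respect to B′»)] -/
def Theta (S : Set (Site P k)) (T : Finset (PBond P k)) (B : GaugeSlice S T E3) : GaugeSlice S T E3 →ₗ[ℝ] VecField P k E3 where
  toFun δ b := theta (ιA S T B b) (ιA S T δ b)
  map_add' δ δ' := by
    funext b
    simp only [map_add, Pi.add_apply]
  map_smul' c δ := by
    funext b
    simp only [map_smul, Pi.smul_apply, RingHom.id_apply]

/-- `Theta` unfolded. [cite: Balaban1989LargeFieldII, p.359] -/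
theorem Theta_apply (S : Set (Site P k)) (T : Finset (PBond P k)) (B δ : GaugeSlice S T E3) (b : PBond P k) :
    Theta S T B δ b = theta (ιA S T B b) (ιA S T δ b) := rfl

/-- `Θ_B δ` vanishes off the free bonds. [cite: Balaban1989LargeFieldII, p.359] -/
theorem Theta_apply_of_not_mem {S : Set (Site P k)} {T : Finset (PBond P k)} (B δ : GaugeSlice S T E3) {b : PBond P k}
    (hb : b ∉ freeBonds S T) : Theta S T B δ b = 0 := by
  rw [Theta_apply, ιA_apply_of_not_mem δ hb, map_zero]

/-- `Θ_B δ` is supported on the free bonds `{b ∈ bondsOf S | b ∉ T}`. [cite: Balaban1989LargeFieldII, p.359] -/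
theorem isSupportedOn_Theta {S : Set (Site P k)} {T : Finset (PBond P k)} (B δ : GaugeSlice S T E3) :
    IsSupportedOn {b | b ∈ bondsOf S ∧ b ∉ T} (Theta S T B δ) :=
  fun _ hb => Theta_apply_of_not_mem B δ fun h => hb (mem_freeBonds.1 h)

/-- **`Θ_B` IS ONTO THE FIELDS SUPPORTED ON THE FREE BONDS** when `‖B‖ ≤ 1/2` (bondwise `theta (ιA B b)` is bijective,
`B15Prop1ChartCalculusSU2.theta_bijective`, `‖ιA B b‖ ≤ ‖B‖`). [cite: Balaban1989LargeFieldII, p.359] -/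
theorem exists_Theta_eq {S : Set (Site P k)} {T : Finset (PBond P k)} {B : GaugeSlice S T E3} (hB : ‖B‖ ≤ 1 / 2)
    {A : VecField P k E3} (hA : IsSupportedOn {b | b ∈ bondsOf S ∧ b ∉ T} A) : ∃ δ : GaugeSlice S T E3, Theta S T B δ = A := by
  have hsurj : ∀ b, Function.Surjective (theta (ιA S T B b)) := fun b =>
    (theta_bijective ((norm_ιA_apply_le B b).trans hB)).2
  choose y hy using fun b => hsurj b (A b)
  refine ⟨WithLp.toLp 2 fun i : ↥(freeBonds S T) => y i.1, funext fun b => ?_⟩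
  by_cases hb : b ∈ freeBonds S T
  · rw [Theta_apply, ιA_apply_of_mem (WithLp.toLp 2 fun i : ↥(freeBonds S T) => y i.1) hb, WithLp.ofLp_toLp]
    exact hy b
  · rw [Theta_apply_of_not_mem _ _ hb]
    exact (hA b fun h => hb (mem_freeBonds.2 h)).symm

/-- **THE SLICE CURVE**: the bond field `sliceCurve B δ s (b) = chartCurve (ιA B b) (ιA δ b) s` with `exp(i·sliceCurve s)·V =
exp(i·ιA(B + sδ))·U` (bondwise `B15Prop1ChartCalculusSU2.chartCurve`). [cite: Balaban1989LargeFieldII, p.359] -/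
def sliceCurve (S : Set (Site P k)) (T : Finset (PBond P k)) (B δ : GaugeSlice S T E3) (s : ℝ) : VecField P k E3 :=
  fun b => chartCurve (ιA S T B b) (ιA S T δ b) s

/-- **`exp(i·sliceCurve s)·(exp(i·ιA B)·U) = exp(i·ιA(B + sδ))·U`** for every `s`. [cite: Balaban1989LargeFieldII, p.359] -/
theorem expMul_sliceCurve (S : Set (Site P k)) (T : Finset (PBond P k)) (U : GaugeField P k SU2) (B δ : GaugeSlice S T E3)
    (s : ℝ) : expMul su2Chart (sliceCurve S T B δ s) (expMul su2Chart (ιA S T B) U) = expMul su2Chart (ιA S T (B + s • δ)) U := by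
  funext b
  simp only [expMul, sliceCurve]
  rw [map_add, map_smul, Pi.add_apply, Pi.smul_apply, ← mul_assoc, iexp_chartCurve_mul]

/-- The slice curve starts at `0`. [cite: Balaban1989LargeFieldII, p.359] -/
theorem sliceCurve_zero (S : Set (Site P k)) (T : Finset (PBond P k)) (B δ : GaugeSlice S T E3) : sliceCurve S T B δ 0 = 0 :=
  funext fun _ => chartCurve_zero _ _

/-- The slice curve has velocity `Θ_B δ` at `s = 0`. [cite: Balaban1989LargeFieldII, p.359] -/
theorem hasDerivAt_sliceCurve (S : Set (Site P k)) (T : Finset (PBond P k)) (B δ : GaugeSlice S T E3) :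
    HasDerivAt (sliceCurve S T B δ) (Theta S T B δ) 0 :=
  hasDerivAt_pi.2 fun _ => hasDerivAt_chartCurve _ _

/-- **PRINT'S COORDINATE VARIATION HAS DERIVATIVE `D (Θ_B δ)`**: if `A ↦ f(exp(iA)·V)` has Fréchet derivative `D` at `0`,
`V = exp(i·ιA B)·U`, then `d/ds f(exp(i·ιA(B + sδ))·U)|_{s=0} = D (Theta B δ)`. [cite: Balaban1989LargeFieldII, p.359 («We expand the
function with respect to B′»)] -/
theorem hasDerivAt_slice_of_hasFDerivAt {S : Set (Site P k)} {T : Finset (PBond P k)} (f : GaugeField P k SU2 → ℝ)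
    (U : GaugeField P k SU2) (B δ : GaugeSlice S T E3) {D : VecField P k E3 →L[ℝ] ℝ}
    (hF : HasFDerivAt (fun A => f (expMul su2Chart A (expMul su2Chart (ιA S T B) U))) D 0) :
    HasDerivAt (fun s : ℝ => f (expMul su2Chart (ιA S T (B + s • δ)) U)) (D (Theta S T B δ)) 0 := by
  have h := hF.comp_hasDerivAt_of_eq 0 (hasDerivAt_sliceCurve S T B δ) (sliceCurve_zero S T B δ).symm
  have heq : (fun s : ℝ => f (expMul su2Chart (ιA S T (B + s • δ)) U)) =
      (fun A => f (expMul su2Chart A (expMul su2Chart (ιA S T B) U))) ∘ sliceCurve S T B δ := by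
    funext s
    rw [Function.comp_apply, expMul_sliceCurve]
  rw [heq]
  exact h

/-! ## §3 The infinitesimal tree gauge (peeling along a fresh-endpoint order) -/

/-- **THE INFINITESIMAL ROOTED TREE GAUGE.**  Along a fresh-endpoint order `TreeOrder T v r` (pv26), for every configuration `V` and every
bond field `A` there is a site field `λ`, VANISHING AT EVERY SITE THAT IS NOT A FRESH END, whose infinitesimal gauge field matches `A`
on `T`: `dGauge V λ = A` on `T`.  Peeling induction on `|T|` exactly as the finite `B15Prop1GaugeFixing.exists_gaugeTransf_freshSupport`:
remove the bond `b₀` of maximal fresh-end rank (its fresh end `x` is touched by no other bond of `T`), solve on `T ∖ {b₀}`, and correct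
`λ` at `x` — by `A(b₀) + Ad_{V(b₀)} λ(b₀₊)` if `x = b₀₋`, by `Ad_{V(b₀)}⁻¹(λ(b₀₋) − A(b₀))` if `x = b₀₊`.
[cite: Balaban1989LargeFieldII, p.359 («Fixing the gauge G₀ for V′»); Balaban1989LargeFieldI, p.196] -/
theorem exists_dGauge_eq {T : Finset (PBond P k)} {v : PBond P k → Site P k} {r : Site P k → ℕ} (hT : TreeOrder T v r)
    (V : GaugeField P k SU2) (A : VecField P k E3) :
    ∃ lam : SiteField P k E3, (∀ b ∈ T, dGauge V lam b = A b) ∧ ∀ y, (∀ b ∈ T, v b ≠ y) → lam y = 0 := by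
  suffices H : ∀ (n : ℕ) (T : Finset (PBond P k)), T.card = n → TreeOrder T v r →
      ∃ lam : SiteField P k E3, (∀ b ∈ T, dGauge V lam b = A b) ∧ ∀ y, (∀ b ∈ T, v b ≠ y) → lam y = 0 from H _ T rfl hT
  intro n
  induction n with
  | zero =>
    intro T hc _
    rw [Finset.card_eq_zero] at hc
    subst hc
    exact ⟨fun _ => 0, fun b hb => absurd hb (Finset.notMem_empty b), fun _ _ => rfl⟩
  | succ n ih =>
    intro T hc hT
    have hne : T.Nonempty := by rw [← Finset.card_pos, hc]; exact Nat.succ_pos n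
    obtain ⟨b₀, hb₀, hmax⟩ := Finset.exists_max_image T (fun b => r (v b)) hne
    have hfresh := hT.fresh_of_max hb₀ hmax
    have hc' : (T.erase b₀).card = n := by rw [Finset.card_erase_of_mem hb₀, hc]; rfl
    obtain ⟨lam', hfix', hsupp'⟩ := ih _ hc' (hT.mono (Finset.erase_subset b₀ T))
    have hx := hT.endpoint b₀ hb₀
    have hne₀ := hT.ne b₀ hb₀
    -- correct at the fresh end `x = v b₀`
    refine ⟨Function.update lam' (v b₀)
        (if b₀.src = v b₀ then A b₀ + adSU2 (V b₀) (lam' b₀.tgt) else adSU2 (V b₀)⁻¹ (lam' b₀.src - A b₀)), ?_, ?_⟩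
    · intro b hb
      by_cases hbb : b = b₀
      · subst hbb
        rcases hx with hx | hx
        · -- the fresh end is the source
          have hs : b.src = v b := hx.symm
          have ht : b.tgt ≠ v b := fun h' => hne₀ (hs.trans h'.symm)
          rw [dGauge_apply, hs, Function.update_self, Function.update_of_ne ht, if_pos rfl]
          exact add_sub_cancel_right _ _
        · -- the fresh end is the target
          have ht : b.tgt = v b := hx.symm
          have hs : b.src ≠ v b := fun h' => hne₀ (h'.trans ht.symm)
          rw [dGauge_apply, ht, Function.update_self, Function.update_of_ne hs, if_neg hs, adSU2_adSU2_inv]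
          exact sub_sub_cancel _ _
      · have hb' : b ∈ T.erase b₀ := Finset.mem_erase.2 ⟨hbb, hb⟩
        obtain ⟨hs, ht⟩ := hfresh b hb'
        rw [dGauge_apply, Function.update_of_ne hs, Function.update_of_ne ht]
        exact hfix' b hb'
    · intro y hy
      have hyx : y ≠ v b₀ := fun h => hy b₀ hb₀ h.symm
      rw [Function.update_of_ne hyx]
      exact hsupp' y fun b hb => hy b (Finset.mem_of_mem_erase hb)

/-! ## §4 Assembly: criticality in all directions ⇔ criticality in the gauge-fixed coordinates -/

/-- **CRITICALITY ⇔ THE DERIVATIVE VANISHES ON THE RANGE OF `Θ_B`.**  Let `T` carry a fresh-endpoint order with fresh ends in `S`, let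
`f` be invariant under the gauge transformations defined on `S`, let `V = exp(i·ιA B)·U` with `‖B‖ ≤ 1/2`, and let `A ↦ f(exp(iA)·V)`
have Fréchet derivative `D` at `0`.  Then `V` is a critical configuration of `f` in the directions supported on `bondsOf S` iff
`D (Θ_B δ) = 0` for every coordinate direction `δ`.  (⇒) `Θ_B δ` is supported on `bondsOf S` and the variation along it has derivative
`D (Θ_B δ)`.  (⇐) For `A` supported on `bondsOf S` write `A = (A − dGauge V λ) + dGauge V λ` with `λ` from the infinitesimal tree gauge
(`exists_dGauge_eq`, supported on the fresh ends ⊆ `S`): the first summand vanishes on `T` and off `bondsOf S`, so it is `Θ_B δ` for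
some `δ` (`exists_Theta_eq`); the second is killed by invariance (`apply_dGauge_eq_zero`). [cite: Balaban1989LargeFieldII, p.359 («Now
the condition for a critical configuration is the equation (1.12)»); Balaban1989LargeFieldI, Prop. 1 (1.77) p.194] -/
theorem isCriticalPt_iff_forall_theta {S : Set (Site P k)} {T : Finset (PBond P k)} {v : PBond P k → Site P k}
    {r : Site P k → ℕ} (hT : TreeOrder T v r) (hv : ∀ b ∈ T, v b ∈ S) {f : GaugeField P k SU2 → ℝ}
    (hf : ∀ u : GaugeTransf P k SU2, IsGaugeOn S u → ∀ V, f (gaugeAct u V) = f V) (U : GaugeField P k SU2)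
    {B : GaugeSlice S T E3} (hB : ‖B‖ ≤ 1 / 2) {D : VecField P k E3 →L[ℝ] ℝ}
    (hF : HasFDerivAt (fun A => f (expMul su2Chart A (expMul su2Chart (ιA S T B) U))) D 0) :
    IsCriticalPt su2Chart (bondsOf S) f (expMul su2Chart (ιA S T B) U) ↔ ∀ δ : GaugeSlice S T E3, D (Theta S T B δ) = 0 := by
  -- the derivative along a line `s ↦ s·A` is `D A`
  have hline : ∀ A : VecField P k E3,
      HasDerivAt (fun s : ℝ => f (expMul su2Chart (s • A) (expMul su2Chart (ιA S T B) U))) (D A) 0 := by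
    intro A
    have h1 : HasDerivAt (fun s : ℝ => s • A) A 0 := by simpa using (hasDerivAt_id (0 : ℝ)).smul_const A
    exact hF.comp_hasDerivAt_of_eq 0 h1 (by rw [zero_smul])
  constructor
  · intro hcrit δ
    have hsupp : IsSupportedOn (bondsOf S) (Theta S T B δ) := fun b hb =>
      Theta_apply_of_not_mem B δ fun h => hb (mem_freeBonds.1 h).1
    exact (hline _).unique (hcrit _ hsupp)
  · intro hslice A hA
    obtain ⟨lam, hfix, hsupp⟩ := exists_dGauge_eq hT (expMul su2Chart (ιA S T B) U) A
    have hlamS : ∀ x, x ∉ S → lam x = 0 := fun x hx => hsupp x fun b hb h => hx (h ▸ hv b hb)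
    have hfree : IsSupportedOn {b | b ∈ bondsOf S ∧ b ∉ T} (A - dGauge (expMul su2Chart (ιA S T B) U) lam) := by
      intro b hb
      by_cases hbS : b ∈ bondsOf S
      · have hbT : b ∈ T := by
          by_contra hbT
          exact hb ⟨hbS, hbT⟩
        rw [Pi.sub_apply, hfix b hbT, sub_self]
      · rw [Pi.sub_apply, hA b hbS, dGauge_apply_of_not_mem hlamS _ hbS, sub_zero]
    obtain ⟨δ, hδ⟩ := exists_Theta_eq hB hfree
    have h1 : D (A - dGauge (expMul su2Chart (ιA S T B) U) lam) = 0 := by rw [← hδ]; exact hslice δ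
    have h2 : D (dGauge (expMul su2Chart (ιA S T B) U) lam) = 0 := apply_dGauge_eq_zero hf hlamS hF
    have hDA : D A = 0 := by
      have h3 : D A = D (A - dGauge (expMul su2Chart (ιA S T B) U) lam) + D (dGauge (expMul su2Chart (ιA S T B) U) lam) := by
        rw [map_sub, sub_add_cancel]
      rw [h3, h1, h2, add_zero]
    have h := hline A
    rwa [hDA] at h

/-- **CRITICALITY ⇔ EVERY COORDINATE VARIATION IS STATIONARY** (same hypotheses): `IsCriticalPt ↔ ∀ δ, d/ds f(exp(i·ιA(B + sδ))·U)|₀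
= 0`. [cite: Balaban1989LargeFieldII, p.359 («We expand the function with respect to B′ … the condition for a critical configuration is
the equation (1.12)»)] -/
theorem isCriticalPt_iff_forall_hasDerivAt_slice {S : Set (Site P k)} {T : Finset (PBond P k)} {v : PBond P k → Site P k}
    {r : Site P k → ℕ} (hT : TreeOrder T v r) (hv : ∀ b ∈ T, v b ∈ S) {f : GaugeField P k SU2 → ℝ}
    (hf : ∀ u : GaugeTransf P k SU2, IsGaugeOn S u → ∀ V, f (gaugeAct u V) = f V) (U : GaugeField P k SU2)
    {B : GaugeSlice S T E3} (hB : ‖B‖ ≤ 1 / 2) {D : VecField P k E3 →L[ℝ] ℝ}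
    (hF : HasFDerivAt (fun A => f (expMul su2Chart A (expMul su2Chart (ιA S T B) U))) D 0) :
    IsCriticalPt su2Chart (bondsOf S) f (expMul su2Chart (ιA S T B) U) ↔
      ∀ δ : GaugeSlice S T E3, HasDerivAt (fun s : ℝ => f (expMul su2Chart (ιA S T (B + s • δ)) U)) 0 0 := by
  rw [isCriticalPt_iff_forall_theta hT hv hf U hB hF]
  refine forall_congr' fun δ => ?_
  have h := hasDerivAt_slice_of_hasFDerivAt f U B δ hF
  exact ⟨fun h0 => h0 ▸ h, fun h0 => h.unique h0⟩

/-- **THE LETTER (c3) GIVEN THE LETTER (m5)** (same hypotheses): if the coordinate variations have a displayed first variation,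
`d/ds f(exp(i·ιA(B + sδ))·U)|₀ = L δ` (at print's instance `L δ = ⟨HδB′, J⟩ + ⟨HδB′, Δ₁HB′⟩ + ⟨HδB′, (δ/δA)V(HB′)⟩`, (1.12)), then
`IsCriticalPt ↔ ∀ δ, L δ = 0`. [cite: Balaban1989LargeFieldII, (1.12) p.359] -/
theorem isCriticalPt_iff_of_hasDerivAt {S : Set (Site P k)} {T : Finset (PBond P k)} {v : PBond P k → Site P k}
    {r : Site P k → ℕ} (hT : TreeOrder T v r) (hv : ∀ b ∈ T, v b ∈ S) {f : GaugeField P k SU2 → ℝ}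
    (hf : ∀ u : GaugeTransf P k SU2, IsGaugeOn S u → ∀ V, f (gaugeAct u V) = f V) (U : GaugeField P k SU2)
    {B : GaugeSlice S T E3} (hB : ‖B‖ ≤ 1 / 2) {D : VecField P k E3 →L[ℝ] ℝ}
    (hF : HasFDerivAt (fun A => f (expMul su2Chart A (expMul su2Chart (ιA S T B) U))) D 0) {L : GaugeSlice S T E3 → ℝ}
    (hA : ∀ δ, HasDerivAt (fun s : ℝ => f (expMul su2Chart (ιA S T (B + s • δ)) U)) (L δ) 0) :
    IsCriticalPt su2Chart (bondsOf S) f (expMul su2Chart (ιA S T B) U) ↔ ∀ δ : GaugeSlice S T E3, L δ = 0 := by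
  rw [isCriticalPt_iff_forall_hasDerivAt_slice hT hv hf U hB hF]
  exact forall_congr' fun δ => ⟨fun h0 => (hA δ).unique h0, fun h0 => h0 ▸ hA δ⟩

end Slice

end Literature.MathematicalPhysics.QuantumFieldTheory.Balaban1983to89.B15Prop1CriticalViaSlice

end
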